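import Summits.NavierStokesRegularity.NavierStokesRegularity.Theorems.IsotropicBlobWitnessFieldRegularity
import Summits.NavierStokesRegularity.NavierStokesRegularity.Theorems.IsotropicBlobArgmaxCover
import Summits.NavierStokesRegularity.NavierStokesRegularity.Theorems.IsotropicBlobSourceProfiles
import Summits.NavierStokesRegularity.NavierStokesRegularity.Theorems.HarmonicShellZonal
import Literature.Geometry.DiscreteGeometry.LayerShells
import HarnessLib

/-!
# THE `C²` WITNESS FIELD of ROUND-41 — (α) the strain form IS `strainFormC2`, (V7) the pressure SOURCE identity
(plate (V), parts (α) = V6-in-coordinates and V7; LEAD S-door ns-s30-p1 g4 PLATE MAP v3 2026-08-28; data nsreg-p1 g33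
`r42/Sketch46.lean` §5 / `r42/f_zonal_k4.txt`, typed BY NAME against ns-s29-p2 g5's `Theorems/IsotropicBlobArgmaxCover`
(`ArgmaxCover.strainFormC2`), LEAD's `Theorems/IsotropicBlobSourceProfiles` (`srcPoly_l`, `srcProfile_l`) and
`Theorems/HarmonicShellZonal` (`polyFun zonal2/4`))

Cell `ns-regularity-ideate`, seat ns-sfl-p1 g6, `--supports stmt-NavierStokesRegularity-0056 --as helper`.

* §1 coordinates (`inner_fin3`/`norm_sq_fin3` reused from `Literature.Geometry.DiscreteGeometry`): `inner_uniaxialS_left`, `norm_uniaxialS_sq`, `polyFun_zonal2_eq`,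
  `polyFun_zonal4_eq` (`Z₂ = 2q`, `Z₄` and `‖Sx‖²` as polynomials of `s = ‖x‖²`, `q = ⟪x,Sx⟫`);
* §2 **(α) `inner_fderiv_witnessFieldC2_eq_strainFormC2 : ‖y‖² < 1 →
  ⟪fderiv ℝ witnessFieldC2 y e, e⟫ = strainFormC2 (y 0) (y 1) (y 2) (e 0) (e 1) (e 2)`** (so W3's
  `strainFormC2_le_normSq` applies verbatim), and `inner_fderiv_witnessFieldC2_le_norm_sq : ⟪Du(y)e,e⟫ ≤ ‖e‖²` for ALL `y`;
* §3 trace toolkit: `traceCLM_comp_smulRight`, `traceCLM_smulRight_comp`, `traceCLM_uniaxialS_comp_uniaxialS = 3/2`;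
* §4 **(V7) `neg_traceCLM_fderiv_sq_witnessFieldC2_of_lt`** (inside: `−tr(Du∘Du) = srcPoly0 s + srcPoly2 s·Z₂ + srcPoly4 s·Z₄`,
  by expanding `Du∘Du` into 16 rank-structured terms whose traces are scalars in `s, q`, then `ring` in TWO variables) and
  **`neg_traceCLM_fderiv_sq_witnessFieldC2 : ∀ x, −traceCLM ((fderiv ℝ witnessFieldC2 x).comp (fderiv ℝ witnessFieldC2 x))
  = srcProfile0 (‖x‖²) + srcProfile2 (‖x‖²) * polyFun zonal2 x + srcProfile4 (‖x‖²) * polyFun zonal4 x`** — literally the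
  `hsrc` hypothesis of LEAD's `isDecayingPressureOf_zonalPressure` with `u := witnessFieldC2`, `F_l := srcProfile_l`.

HONEST FRAMING: kinematic slice witness calculus; item 0056 `NoTypeII` and NS regularity NOT proved; no summit statement
is proved by this seat.
-/

noncomputable section

open MeasureTheory Set Function Filter Metric Real InnerProductSpace
open _root_.Topology
open scoped ENNReal NNReal RealInnerProductSpace ContDiff Laplacian
open Literature.Analysis Literature.Analysis.FluidPDE VectorCalculus

namespace Summit.NavierStokesRegularity.NavierStokesRegularity.Theorems.StrainDoors.IsotropicBlob

open Summit.NavierStokesRegularity.NavierStokesRegularity.Theorems.ArgmaxDoors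
open Summit.NavierStokesRegularity.NavierStokesRegularity.Theorems.StrainDoors
open Summit.NavierStokesRegularity.NavierStokesRegularity.Theorems.StrainDoors.HarmonicShell

set_option linter.dupNamespace false

/-! ## §1 Coordinates -/

/- coordinates `⟪v, w⟫ = Σ vᵢwᵢ`, `‖v‖² = Σ vᵢ²` on `ℝ³`: REUSED from the tree (`Literature.Geometry.DiscreteGeometry.inner_fin3`,
`norm_sq_fin3`, gate dedup), not restated. -/

/-- `⟪Sy, e⟫ = y₂e₂ − (y₀e₀ + y₁e₁)/2`. -/
theorem inner_uniaxialS_left (y e : E3) : ⟪uniaxialS y, e⟫ = y 2 * e 2 - (y 0 * e 0 + y 1 * e 1) / 2 := by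
  obtain ⟨h0, h1, h2⟩ := uniaxialS_apply y
  rw [Literature.Geometry.DiscreteGeometry.inner_fin3, h0, h1, h2]; ring

/-- `‖Sx‖² = (‖x‖² + ⟪x,Sx⟫)/2`. -/
theorem norm_uniaxialS_sq (x : E3) : ‖uniaxialS x‖ ^ 2 = (‖x‖ ^ 2 + ⟪x, uniaxialS x⟫) / 2 := by
  obtain ⟨h0, h1, h2⟩ := uniaxialS_apply x
  rw [Literature.Geometry.DiscreteGeometry.norm_sq_fin3, Literature.Geometry.DiscreteGeometry.norm_sq_fin3, inner_uniaxialS,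
    h0, h1, h2]; ring

/-- `Z₂(x) = 2⟪x, Sx⟫`. -/
theorem polyFun_zonal2_eq (x : E3) : polyFun zonal2 x = 2 * ⟪x, uniaxialS x⟫ := by
  rw [polyFun_zonal2, inner_uniaxialS]; ring

/-- `Z₄(x)` as a polynomial of `s = ‖x‖²` and `q = ⟪x, Sx⟫` (`x₂² = (s+2q)/3`, `x₀²+x₁² = 2(s−q)/3`). -/
theorem polyFun_zonal4_eq (x : E3) : polyFun zonal4 x =
    (8 * (‖x‖ ^ 2 + 2 * ⟪x, uniaxialS x⟫) ^ 2 - 48 * (‖x‖ ^ 2 + 2 * ⟪x, uniaxialS x⟫) * (‖x‖ ^ 2 - ⟪x, uniaxialS x⟫) +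
      12 * (‖x‖ ^ 2 - ⟪x, uniaxialS x⟫) ^ 2) / 9 := by
  rw [polyFun_zonal4, inner_uniaxialS, Literature.Geometry.DiscreteGeometry.norm_sq_fin3]; ring

/-! ## §2 (α) The strain form of the witness is `strainFormC2` -/

/-- **(α)** on the open unit ball the quadratic form of `fderiv ℝ witnessFieldC2 y` is p1's six-variable polynomial
`ArgmaxCover.strainFormC2` (W3's `strainFormC2_le_normSq` then applies verbatim). -/
theorem inner_fderiv_witnessFieldC2_eq_strainFormC2 {y : E3} (hy : ‖y‖ ^ 2 < 1) (e : E3) :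
    ⟪fderiv ℝ witnessFieldC2 y e, e⟫ = ArgmaxCover.strainFormC2 (y 0) (y 1) (y 2) (e 0) (e 1) (e 2) := by
  rw [inner_fderiv_witnessFieldC2_of_lt hy, inner_uniaxialS_left e e, inner_uniaxialS_left y e, inner_uniaxialS y,
    Literature.Geometry.DiscreteGeometry.inner_fin3 y e, Literature.Geometry.DiscreteGeometry.norm_sq_fin3 y,
    Literature.Geometry.DiscreteGeometry.norm_sq_fin3 e]
  unfold ArgmaxCover.strainFormC2
  ring

/-- **(α) + W3 + (γ)**: `⟪Du(y) e, e⟫ ≤ ‖e‖²` for EVERY `y` (inside: `strainFormC2_le_normSq`; on `1 ≤ ‖y‖²`: `Du = 0`). -/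
theorem inner_fderiv_witnessFieldC2_le_norm_sq (y e : E3) : ⟪fderiv ℝ witnessFieldC2 y e, e⟫ ≤ ‖e‖ ^ 2 := by
  by_cases hy : ‖y‖ ^ 2 < 1
  · rw [inner_fderiv_witnessFieldC2_eq_strainFormC2 hy, Literature.Geometry.DiscreteGeometry.norm_sq_fin3 e]
    exact ArgmaxCover.strainFormC2_le_normSq
      (by rw [← Literature.Geometry.DiscreteGeometry.norm_sq_fin3]; exact hy.le) _ _ _
  · rw [fderiv_witnessFieldC2_of_le (not_lt.1 hy)]
    simp only [zero_apply, inner_zero_left]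
    positivity

/-! ## §3 Trace toolkit -/

/-- `tr(M ∘ (f ⊗ y)) = f(My)`. -/
theorem traceCLM_comp_smulRight (M : E3 →L[ℝ] E3) (f : E3 →L[ℝ] ℝ) (y : E3) :
    traceCLM (M.comp (f.smulRight y)) = f (M y) := by
  have h : M.comp (f.smulRight y) = f.smulRight (M y) := by
    ext z
    simp [ContinuousLinearMap.smulRight_apply, map_smul]
  rw [h, traceCLM_smulRight]

/-- `tr((f ⊗ y) ∘ M) = f(My)`. -/
theorem traceCLM_smulRight_comp (f : E3 →L[ℝ] ℝ) (y : E3) (M : E3 →L[ℝ] E3) :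
    traceCLM ((f.smulRight y).comp M) = f (M y) := by
  have h : (f.smulRight y).comp M = (f.comp M).smulRight y := by
    ext z
    simp [ContinuousLinearMap.smulRight_apply]
  rw [h, traceCLM_smulRight, ContinuousLinearMap.comp_apply]

/-- Coordinates of `S(Sv) = (v₀/4, v₁/4, v₂)`. -/
theorem uniaxialS_uniaxialS_apply (v : E3) :
    uniaxialS (uniaxialS v) 0 = v 0 / 4 ∧ uniaxialS (uniaxialS v) 1 = v 1 / 4 ∧ uniaxialS (uniaxialS v) 2 = v 2 := by
  obtain ⟨a0, a1, a2⟩ := uniaxialS_apply (uniaxialS v)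
  obtain ⟨b0, b1, b2⟩ := uniaxialS_apply v
  rw [a0, a1, a2, b0, b1, b2]
  exact ⟨by ring, by ring, rfl⟩

/-- `tr(S ∘ S) = 3/2`. -/
theorem traceCLM_uniaxialS_comp_uniaxialS : traceCLM (uniaxialS.comp uniaxialS) = 3 / 2 := by
  rw [traceCLM_eq_sum_inner (EuclideanSpace.basisFun (Fin 3) ℝ), Fin.sum_univ_three]
  obtain ⟨h0, -, -⟩ := uniaxialS_uniaxialS_apply (EuclideanSpace.single (0 : Fin 3) (1 : ℝ))
  obtain ⟨-, h1, -⟩ := uniaxialS_uniaxialS_apply (EuclideanSpace.single (1 : Fin 3) (1 : ℝ))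
  obtain ⟨-, -, h2⟩ := uniaxialS_uniaxialS_apply (EuclideanSpace.single (2 : Fin 3) (1 : ℝ))
  norm_num [EuclideanSpace.basisFun_apply, ContinuousLinearMap.comp_apply, EuclideanSpace.inner_single_left, h0, h1, h2]

/-! ## §4 (V7) The pressure source `−tr(Du ∘ Du)` -/

/-- **(V7) INSIDE THE BALL**: `−tr(Du(x) ∘ Du(x)) = F₀(s) + F₂(s)·Z₂(x) + F₄(s)·Z₄(x)`, `s = ‖x‖² < 1`, with p1's
`srcPoly0/2/4` (r42/f_zonal_k4.txt) and the zonal harmonics `polyFun zonal2/4`. -/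
theorem neg_traceCLM_fderiv_sq_witnessFieldC2_of_lt {x : E3} (hx : ‖x‖ ^ 2 < 1) :
    -traceCLM ((fderiv ℝ witnessFieldC2 x).comp (fderiv ℝ witnessFieldC2 x)) =
      srcPoly0 (‖x‖ ^ 2) + srcPoly2 (‖x‖ ^ 2) * polyFun zonal2 x + srcPoly4 (‖x‖ ^ 2) * polyFun zonal4 x := by
  rw [(hasFDerivAt_witnessFieldC2_of_lt hx).fderiv]
  simp only [ContinuousLinearMap.add_comp, ContinuousLinearMap.comp_add, ContinuousLinearMap.smul_comp,
    ContinuousLinearMap.comp_smul, ContinuousLinearMap.id_comp, ContinuousLinearMap.comp_id, map_add, map_smul,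
    traceCLM_comp_smulRight, traceCLM_smulRight_comp, traceCLM_smulRight, traceCLM_uniaxialS, traceCLM_id_E3,
    traceCLM_uniaxialS_comp_uniaxialS, smul_eq_mul, _root_.smul_apply, _root_.add_apply,
    ContinuousLinearMap.smulRight_apply, innerSL_apply_apply, real_inner_self_eq_norm_sq, mul_zero, add_zero, zero_add]
  rw [← uniaxialS_symm x (uniaxialS x), real_inner_self_eq_norm_sq, real_inner_comm x (uniaxialS x),
    norm_uniaxialS_sq, polyFun_zonal2_eq, polyFun_zonal4_eq]
  unfold srcPoly0 srcPoly2 srcPoly4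
  ring

/-- **(V7) THE SOURCE IDENTITY AT EVERY POINT** — literally the `hsrc` hypothesis of LEAD's
`isDecayingPressureOf_zonalPressure` with `u := witnessFieldC2`, `F_l := srcProfile_l` (outside the open ball both
sides vanish: `Du = 0` and `srcProfile_l = 0` on `1 ≤ s`). -/
theorem neg_traceCLM_fderiv_sq_witnessFieldC2 (x : E3) :
    -traceCLM ((fderiv ℝ witnessFieldC2 x).comp (fderiv ℝ witnessFieldC2 x)) =
      srcProfile0 (‖x‖ ^ 2) + srcProfile2 (‖x‖ ^ 2) * polyFun zonal2 x + srcProfile4 (‖x‖ ^ 2) * polyFun zonal4 x := by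
  by_cases hx : ‖x‖ ^ 2 < 1
  · rw [srcProfile0_of_le hx.le, srcProfile2_of_le hx.le, srcProfile4_of_le hx.le]
    exact neg_traceCLM_fderiv_sq_witnessFieldC2_of_lt hx
  · have hx' : 1 ≤ ‖x‖ ^ 2 := not_lt.1 hx
    rw [fderiv_witnessFieldC2_of_le hx', srcProfile0_of_ge hx', srcProfile2_of_ge hx', srcProfile4_of_ge hx']
    simp

end Summit.NavierStokesRegularity.NavierStokesRegularity.Theorems.StrainDoors.IsotropicBlob

end
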